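import Summits.KontsevichZagierPeriods.KontsevichZagierPeriods.Theorems.RootDecompWalshStrataScaledLW01

/-!
# Root decomposition & Walsh strata — the scaled rational class for `L³·W` denominators, part 2 (gen 8, §35.4–35.5)

Partial fractions over `ℚ` on top of the atoms of part 1 and the landed ones: division by
`W = κ₀ + κ₁X²` (`InBaker.sqrt_const_div_W`), by `(X − a)³` (`InBaker.sqrt_const_div_Lcube`), by both
(Bézout, `InBaker.sqrt_const_div_LcubeW`), and the class `[T, N/(s·L³·W)·√m] ∈ InBaker`
(`InBaker.sqrt_const_LW`) consumed by the line-wall terminal of §34.  See part 1 for the overview.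
[KontsevichZagier2001 §1.2; Euler 1768; this node]
-/

noncomputable section

open Set MeasureTheory Literature.NumberTheory.Transcendental
open Literature.ModelTheory.ExponentialFields (IsSemialgebraic isSemialgebraic_univ
  isSemialgebraic_setOf_eval_pos)

namespace Summit.KontsevichZagierPeriods.RootDecompWalshStrata.ConicDescent

/-! #### 35.4 Division by `W` and by `L³` -/

/-- `[T, N/W·√m] ∈ InBaker` for `W = κ₀ + κ₁X²` (`κ₀ > 0`, `κ₁ ≥ 0`), `T ⊆ [0, 1]`, any `N ∈ ℚ[X]`:
`N = q·(X² + κ₀/κ₁) + (αX + β)` splits the integrand into a polynomial, the even part `β/W` and the odd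
part `αX/W` (`peel_sqrt_const` twice; `sqrt_const_poly/_even/_oddW`). [this node] -/
theorem InBaker.sqrt_const_div_W (m : ℚ) (hm : 0 < m) (κ₀ κ₁ : ℚ) (hκ₀ : 0 < κ₀) (hκ₁ : 0 ≤ κ₁)
    (N : Polynomial ℚ) (r : KZ.IntegralRep 1) (hI : ∀ v ∈ r.domain, 0 ≤ v 0 ∧ v 0 ≤ 1)
    (hr : EqOn r.integrand (fun v => Polynomial.aeval (v 0) N /
      Polynomial.aeval (v 0) (Polynomial.C κ₀ + Polynomial.C κ₁ * Polynomial.X ^ 2) *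
        √(qD 0 0 m (v 0))) r.domain) :
    InBaker (KZ.of r) := by
  have hκ₀' : (0 : ℝ) < κ₀ := by exact_mod_cast hκ₀
  have hκ₁' : (0 : ℝ) ≤ κ₁ := by exact_mod_cast hκ₁
  have hI' : ∀ r' : KZ.IntegralRep 1, r'.domain = r.domain → r'.domain ⊆ Icc 0 1 :=
    fun r' h v hv => ⟨fun i => by rw [Subsingleton.elim i 0]; exact (hI v (h ▸ hv)).1,
      fun i => by rw [Subsingleton.elim i 0]; exact (hI v (h ▸ hv)).2⟩
  have hdom : ∀ v ∈ r.domain, ((0 : ℚ) : ℝ) ≤ v 0 ∧ v 0 ≤ (1 : ℚ) := fun v hv => by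
    push_cast; exact hI v hv
  have hWx : ∀ x : ℝ, Polynomial.aeval x (Polynomial.C κ₀ + Polynomial.C κ₁ * Polynomial.X ^ 2) =
      κ₀ + κ₁ * x ^ 2 := fun x => by
    simp only [map_add, map_mul, map_pow, Polynomial.aeval_C, Polynomial.aeval_X, eq_ratCast]
  have hWpos : ∀ x : ℝ, (0 : ℝ) < κ₀ + κ₁ * x ^ 2 := fun x => by positivity
  rcases hκ₁.eq_or_lt with hk | hk
  · -- `κ₁ = 0`: a polynomial
    refine InBaker.sqrt_const_poly m hm (Polynomial.C κ₀⁻¹ * N) r (hI' r rfl) fun v hv => ?_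
    rw [hr hv]
    beta_reduce
    rw [hWx, ← hk]
    simp only [map_mul, Polynomial.aeval_C, eq_ratCast]
    push_cast
    simp only [zero_mul, add_zero]
    ring
  -- `κ₁ > 0`: divide by the monic `X² + κ₀/κ₁`
  have hk' : (0 : ℝ) < κ₁ := by exact_mod_cast hk
  obtain ⟨Wm, hWm⟩ : ∃ Wm : Polynomial ℚ, Wm = Polynomial.X ^ 2 + Polynomial.C (κ₀ / κ₁) := ⟨_, rfl⟩
  have hmon : Wm.Monic := by rw [hWm]; exact Polynomial.monic_X_pow_add_C _ two_ne_zero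
  have hdeg : Wm.degree = ((2 : ℕ) : WithBot ℕ) := by
    rw [hWm]; exact Polynomial.degree_X_pow_add_C two_pos _
  obtain ⟨q, hq⟩ : ∃ q : Polynomial ℚ, q = N /ₘ Wm := ⟨_, rfl⟩
  obtain ⟨R, hR⟩ : ∃ R : Polynomial ℚ, R = N %ₘ Wm := ⟨_, rfl⟩
  have hdiv : R + Wm * q = N := by rw [hR, hq]; exact Polynomial.modByMonic_add_div N Wm
  have hRdeg : R.natDegree ≤ 1 := by
    have h : R.degree < ((2 : ℕ) : WithBot ℕ) := by
      rw [hR, ← hdeg]; exact Polynomial.degree_modByMonic_lt N hmon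
    by_cases hR0 : R = 0
    · simp [hR0]
    · have := (Polynomial.natDegree_lt_iff_degree_lt hR0).2 h
      omega
  have hRe : R = Polynomial.C (R.coeff 1) * Polynomial.X + Polynomial.C (R.coeff 0) :=
    Polynomial.eq_X_add_C_of_natDegree_le_one hRdeg
  obtain ⟨α, hα⟩ : ∃ α : ℚ, α = R.coeff 1 := ⟨_, rfl⟩
  obtain ⟨β, hβ⟩ : ∃ β : ℚ, β = R.coeff 0 := ⟨_, rfl⟩
  rw [← hα, ← hβ] at hRe
  have hNx : ∀ x : ℝ, Polynomial.aeval x N =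
      (α * x + β) + (x ^ 2 + κ₀ / κ₁) * Polynomial.aeval x q := fun x => by
    rw [← hdiv, hRe, hWm]
    simp only [map_add, map_mul, map_pow, Polynomial.aeval_C, Polynomial.aeval_X, eq_ratCast]
    push_cast
    ring
  -- the odd part, as handed down twice
  refine InBaker.peel_sqrt_const m (Polynomial.C κ₁⁻¹ * q) 1 0 1 (fun x _ _ => by simp) r hdom
    (fun v => Polynomial.aeval (v 0) (Polynomial.C β) /
      Polynomial.aeval (v 0) (Polynomial.C κ₀ + Polynomial.C κ₁ * Polynomial.X ^ 2) *
        √(qD 0 0 m (v 0)) + (α : ℝ) * v 0 / (κ₀ + κ₁ * v 0 ^ 2) * √(qD 0 0 m (v 0)))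
    (fun v hv => ?_) (fun rA hdA hiA => ?_) fun rB hdB hiB => ?_
  · -- the pointwise identity
    rw [hr hv]
    beta_reduce
    rw [hNx]
    simp only [hWx, map_mul, map_one, Polynomial.aeval_C, eq_ratCast]
    have hW0 := (hWpos (v 0)).ne'
    have hk0 := hk'.ne'
    push_cast
    field_simp
    ring
  · exact InBaker.sqrt_const_poly m hm (Polynomial.C κ₁⁻¹ * q) rA (hI' rA hdA) fun v hv => by
      rw [hiA hv]; beta_reduce; rw [map_one, div_one]
  · refine InBaker.peel_sqrt_const m (Polynomial.C β)
      (Polynomial.C κ₀ + Polynomial.C κ₁ * Polynomial.X ^ 2) 0 1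
      (fun x _ _ => by rw [hWx]; exact (hWpos x).ne') rB (fun v hv => hdom v (hdB ▸ hv)) _ hiB
      (fun rA hdA hiA => ?_) fun rB' hdB' hiB' => ?_
    · refine InBaker.sqrt_const_even m hm (Polynomial.C β) (Polynomial.C κ₀ + Polynomial.C κ₁ *
        Polynomial.X) rA (fun v _ => ?_) fun v hv => ?_
      · simp only [map_add, map_mul, Polynomial.aeval_C, Polynomial.aeval_X, eq_ratCast]
        exact (hWpos (v 0)).ne'
      · rw [hiA hv]
        beta_reduce
        rw [hWx]
        simp only [map_add, map_mul, Polynomial.aeval_C, Polynomial.aeval_X, eq_ratCast]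
    · exact InBaker.sqrt_const_oddW m κ₀ κ₁ α hm hκ₀ hκ₁ rB'
        (fun v hv => hI v (hdB ▸ hdB' ▸ hv)) hiB'

/-- `[T, N/(e₀(X − a)³)·√m] ∈ InBaker` for `T ⊆ [0, 1]` inside a rational hull missing `a`, any `N`:
three divisions by the monic `X − a` give `N = n₀ + n₁(X − a) + n₂(X − a)² + N₃(X − a)³`, and the four
summands are a polynomial and scaled simple/double/triple poles (`peel_sqrt_const` three times).
[this node] -/
theorem InBaker.sqrt_const_div_Lcube (m : ℚ) (hm : 0 < m) (a e₀ : ℚ) (he₀ : e₀ ≠ 0)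
    (N : Polynomial ℚ) (lo hi : ℚ) (hL : ∀ x : ℝ, (lo : ℝ) ≤ x → x ≤ hi → x - a ≠ 0)
    (r : KZ.IntegralRep 1) (hdom : ∀ v ∈ r.domain, (lo : ℝ) ≤ v 0 ∧ v 0 ≤ hi)
    (hI : ∀ v ∈ r.domain, 0 ≤ v 0 ∧ v 0 ≤ 1)
    (hr : EqOn r.integrand (fun v => Polynomial.aeval (v 0) N /
      Polynomial.aeval (v 0) (Polynomial.C e₀ * (Polynomial.X - Polynomial.C a) ^ 3) *
        √(qD 0 0 m (v 0))) r.domain) :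
    InBaker (KZ.of r) := by
  have he₀' : (e₀ : ℝ) ≠ 0 := by exact_mod_cast he₀
  have hI' : ∀ r' : KZ.IntegralRep 1, r'.domain = r.domain → r'.domain ⊆ Icc 0 1 :=
    fun r' h v hv => ⟨fun i => by rw [Subsingleton.elim i 0]; exact (hI v (h ▸ hv)).1,
      fun i => by rw [Subsingleton.elim i 0]; exact (hI v (h ▸ hv)).2⟩
  -- three divisions by `X − a`
  obtain ⟨L, hLdef⟩ : ∃ L : Polynomial ℚ, L = Polynomial.X - Polynomial.C a := ⟨_, rfl⟩
  have hstep : ∀ P : Polynomial ℚ, P = Polynomial.C (P.eval a) + L * (P /ₘ L) := fun P => by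
    conv_lhs => rw [← Polynomial.modByMonic_add_div P L]
    rw [hLdef, Polynomial.modByMonic_X_sub_C_eq_C_eval]
  obtain ⟨N₁, hN₁⟩ : ∃ N₁ : Polynomial ℚ, N₁ = N /ₘ L := ⟨_, rfl⟩
  obtain ⟨N₂, hN₂⟩ : ∃ N₂ : Polynomial ℚ, N₂ = N₁ /ₘ L := ⟨_, rfl⟩
  obtain ⟨N₃, hN₃⟩ : ∃ N₃ : Polynomial ℚ, N₃ = N₂ /ₘ L := ⟨_, rfl⟩
  obtain ⟨n₀, hn₀⟩ : ∃ n₀ : ℚ, n₀ = N.eval a := ⟨_, rfl⟩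
  obtain ⟨n₁, hn₁⟩ : ∃ n₁ : ℚ, n₁ = N₁.eval a := ⟨_, rfl⟩
  obtain ⟨n₂, hn₂⟩ : ∃ n₂ : ℚ, n₂ = N₂.eval a := ⟨_, rfl⟩
  have hNexp : N = Polynomial.C n₀ + L * (Polynomial.C n₁ + L * (Polynomial.C n₂ + L * N₃)) := by
    rw [hn₀, hn₁, hn₂, hN₃, ← hstep N₂, hN₂, ← hstep N₁, hN₁, ← hstep N]
  have hNx : ∀ x : ℝ, Polynomial.aeval x N =
      n₀ + (x - a) * (n₁ + (x - a) * (n₂ + (x - a) * Polynomial.aeval x N₃)) := fun x => by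
    rw [hNexp, hLdef]
    simp only [map_add, map_sub, map_mul, Polynomial.aeval_C, Polynomial.aeval_X, eq_ratCast]
  have hLx : ∀ x : ℝ, Polynomial.aeval x (Polynomial.X - Polynomial.C a) = x - a := fun x => by
    simp only [map_sub, Polynomial.aeval_C, Polynomial.aeval_X, eq_ratCast]
  refine InBaker.peel_sqrt_const m (Polynomial.C e₀⁻¹ * N₃) 1 lo hi (fun x _ _ => by simp) r hdom
    (fun v => Polynomial.aeval (v 0) (Polynomial.C (n₂ / e₀)) /
      Polynomial.aeval (v 0) (Polynomial.X - Polynomial.C a) * √(qD 0 0 m (v 0)) +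
      (Polynomial.aeval (v 0) (Polynomial.C (n₁ / e₀)) /
        Polynomial.aeval (v 0) ((Polynomial.X - Polynomial.C a) ^ 2) * √(qD 0 0 m (v 0)) +
        ((n₀ / e₀ : ℚ) : ℝ) / (v 0 - a) ^ 3 * √(qD 0 0 m (v 0))))
    (fun v hv => ?_) (fun rA hdA hiA => ?_) fun rB hdB hiB => ?_
  · -- the pointwise identity
    have hℓ := hL (v 0) (hdom v hv).1 (hdom v hv).2
    rw [hr hv]
    beta_reduce
    rw [hNx]
    simp only [map_mul, map_pow, map_sub, map_one, Polynomial.aeval_C, Polynomial.aeval_X,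
      eq_ratCast]
    push_cast
    field_simp
    ring
  · exact InBaker.sqrt_const_poly m hm (Polynomial.C e₀⁻¹ * N₃) rA (hI' rA hdA) fun v hv => by
      rw [hiA hv]; beta_reduce; rw [map_one, div_one]
  · refine InBaker.peel_sqrt_const m (Polynomial.C (n₂ / e₀)) (Polynomial.X - Polynomial.C a) lo hi
      (fun x h1 h2 => by rw [hLx]; exact hL x h1 h2) rB (fun v hv => hdom v (hdB ▸ hv)) _ hiB
      (fun rA hdA hiA => ?_) fun rB' hdB' hiB' => ?_
    · exact InBaker.sqrt_const_pole m a (n₂ / e₀) hm rA fun v hv => by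
        rw [hiA hv]; beta_reduce; rw [hLx]; simp only [Polynomial.aeval_C, eq_ratCast]
    · refine InBaker.peel_sqrt_const m (Polynomial.C (n₁ / e₀)) ((Polynomial.X - Polynomial.C a) ^ 2)
        lo hi (fun x h1 h2 => by rw [map_pow, hLx]; exact pow_ne_zero 2 (hL x h1 h2)) rB'
        (fun v hv => hdom v (hdB ▸ hdB' ▸ hv)) _ hiB' (fun rA hdA hiA => ?_)
        fun rB'' _ hiB'' => ?_
      · exact InBaker.sqrt_const_dpole m a (n₁ / e₀) hm rA fun v hv => by
          rw [hiA hv]; beta_reduce; rw [map_pow, hLx]; simp only [Polynomial.aeval_C, eq_ratCast]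
      · exact InBaker.sqrt_const_tpole m a (n₀ / e₀) hm rB'' hiB''

/-- `[T, N/(e₀(X − a)³·W)·√m] ∈ InBaker` (`W = κ₀ + κ₁X²`, `κ₀ > 0`, `κ₁ ≥ 0`, `T ⊆ [0, 1]` inside a
rational hull missing `a`): Bézout `u(X − a)³ + wW = 1` over `ℚ` (`W(a) > 0`) splits the integrand into
`N·w/(e₀(X − a)³)·√m` (`sqrt_const_div_Lcube`) and `N·u/(e₀W)·√m` (`sqrt_const_div_W`). [this node] -/
theorem InBaker.sqrt_const_div_LcubeW (m : ℚ) (hm : 0 < m) (κ₀ κ₁ : ℚ) (hκ₀ : 0 < κ₀)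
    (hκ₁ : 0 ≤ κ₁) (a e₀ : ℚ) (he₀ : e₀ ≠ 0) (N : Polynomial ℚ) (lo hi : ℚ)
    (hL : ∀ x : ℝ, (lo : ℝ) ≤ x → x ≤ hi → x - a ≠ 0)
    (r : KZ.IntegralRep 1) (hdom : ∀ v ∈ r.domain, (lo : ℝ) ≤ v 0 ∧ v 0 ≤ hi)
    (hI : ∀ v ∈ r.domain, 0 ≤ v 0 ∧ v 0 ≤ 1)
    (hr : EqOn r.integrand (fun v => Polynomial.aeval (v 0) N /
      Polynomial.aeval (v 0) (Polynomial.C e₀ * (Polynomial.X - Polynomial.C a) ^ 3 *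
        (Polynomial.C κ₀ + Polynomial.C κ₁ * Polynomial.X ^ 2)) * √(qD 0 0 m (v 0))) r.domain) :
    InBaker (KZ.of r) := by
  have he₀' : (e₀ : ℝ) ≠ 0 := by exact_mod_cast he₀
  have hκ₀' : (0 : ℝ) < κ₀ := by exact_mod_cast hκ₀
  have hκ₁' : (0 : ℝ) ≤ κ₁ := by exact_mod_cast hκ₁
  have hWx : ∀ x : ℝ, Polynomial.aeval x (Polynomial.C κ₀ + Polynomial.C κ₁ * Polynomial.X ^ 2) =
      κ₀ + κ₁ * x ^ 2 := fun x => by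
    simp only [map_add, map_mul, map_pow, Polynomial.aeval_C, Polynomial.aeval_X, eq_ratCast]
  have hWpos : ∀ x : ℝ, (0 : ℝ) < κ₀ + κ₁ * x ^ 2 := fun x => by positivity
  have hLx : ∀ x : ℝ, Polynomial.aeval x (Polynomial.X - Polynomial.C a) = x - a := fun x => by
    simp only [map_sub, Polynomial.aeval_C, Polynomial.aeval_X, eq_ratCast]
  have hcop : IsCoprime ((Polynomial.X - Polynomial.C a) ^ 3)
      (Polynomial.C κ₀ + Polynomial.C κ₁ * Polynomial.X ^ 2) := by
    refine (isCoprime_X_sub_C_of_eval_ne_zero _ a ?_).pow_left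
    have h : (0 : ℚ) < κ₀ + κ₁ * a ^ 2 := by positivity
    simpa using h.ne'
  obtain ⟨u, w, huw⟩ := hcop
  refine InBaker.peel_sqrt_const m (N * w) (Polynomial.C e₀ * (Polynomial.X - Polynomial.C a) ^ 3)
    lo hi (fun x h1 h2 => ?_) r hdom
    (fun v => Polynomial.aeval (v 0) (N * u) /
      Polynomial.aeval (v 0) (Polynomial.C e₀ * (Polynomial.C κ₀ + Polynomial.C κ₁ * Polynomial.X ^ 2)) *
        √(qD 0 0 m (v 0)))
    (fun v hv => ?_) (fun rA hdA hiA => ?_) fun rB hdB hiB => ?_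
  · rw [map_mul, map_pow, hLx]
    simp only [Polynomial.aeval_C, eq_ratCast]
    exact mul_ne_zero he₀' (pow_ne_zero 3 (hL x h1 h2))
  · -- the pointwise identity from Bézout
    have hℓ := hL (v 0) (hdom v hv).1 (hdom v hv).2
    have hW0 := (hWpos (v 0)).ne'
    have hid : Polynomial.aeval (v 0) u * (v 0 - a) ^ 3 +
        Polynomial.aeval (v 0) w * (κ₀ + κ₁ * v 0 ^ 2) = 1 := by
      have h := congrArg (Polynomial.aeval (v 0)) huw
      rw [map_add, map_mul, map_mul, map_pow, hLx, hWx, map_one] at h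
      exact h
    rw [hr hv]
    beta_reduce
    simp only [map_mul, map_pow, hLx, hWx, Polynomial.aeval_C, eq_ratCast, ← add_mul]
    congr 1
    rw [div_add_div _ _ (mul_ne_zero he₀' (pow_ne_zero 3 hℓ)) (mul_ne_zero he₀' hW0),
      div_eq_div_iff (mul_ne_zero (mul_ne_zero he₀' (pow_ne_zero 3 hℓ)) hW0)
        (mul_ne_zero (mul_ne_zero he₀' (pow_ne_zero 3 hℓ)) (mul_ne_zero he₀' hW0))]
    linear_combination (-((e₀ : ℝ) ^ 2 * (v 0 - a) ^ 3 * ((κ₀ : ℝ) + κ₁ * v 0 ^ 2) *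
      Polynomial.aeval (v 0) N)) * hid
  · exact InBaker.sqrt_const_div_Lcube m hm a e₀ he₀ (N * w) lo hi hL rA
      (fun v hv => hdom v (hdA ▸ hv)) (fun v hv => hI v (hdA ▸ hv)) hiA
  · refine InBaker.sqrt_const_div_W m hm κ₀ κ₁ hκ₀ hκ₁ (Polynomial.C e₀⁻¹ * (N * u)) rB
      (fun v hv => hI v (hdB ▸ hv)) fun v hv => ?_
    rw [hiB hv]
    beta_reduce
    rw [map_mul (Polynomial.aeval (v 0)) (Polynomial.C e₀), hWx]
    simp only [map_mul, Polynomial.aeval_C, eq_ratCast]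
    have hW0 := (hWpos (v 0)).ne'
    push_cast
    field_simp

/-! #### 35.5 The class `L³W` -/

/-- **THE SCALED RATIONAL CLASS FOR `Q = s·L³·W`.** For `0 < m ∈ ℚ`, weights `κ₀ > 0`, `κ₁ ≥ 0`,
`s ≠ 0`, a rational line factor `L = k₁ + k₂X` non-vanishing on a rational hull `[lo, hi]` of a domain
`T ⊆ [0, 1]`, and ANY numerator `N ∈ ℚ[X]`:
`[T, N/((sk₁ + sk₂X)(k₁ + k₂X)²(κ₀ + κ₁X²))·√m] ∈ InBaker` — the constant-radicand stratum of the
line-wall sections of the elliptic-polar engine (`k₂ = 0`: `sqrt_const_div_W`; `k₂ ≠ 0`: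
`sqrt_const_div_LcubeW` with `a = −k₁/k₂`, `e₀ = sk₂³`). [this node] -/
theorem InBaker.sqrt_const_LW (m : ℚ) (hm : 0 < m) {κ₀ κ₁ : ℚ} (hκ : 0 < κ₀ ∧ 0 ≤ κ₁)
    (s k₁ k₂ : ℚ) (hs : s ≠ 0) (N : Polynomial ℚ) (lo hi : ℚ)
    (hL : ∀ x : ℝ, (lo : ℝ) ≤ x → x ≤ hi → (k₁ : ℝ) + k₂ * x ≠ 0)
    (r : KZ.IntegralRep 1) (hdom : ∀ v ∈ r.domain, (lo : ℝ) ≤ v 0 ∧ v 0 ≤ hi)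
    (hI : ∀ v ∈ r.domain, 0 ≤ v 0 ∧ v 0 ≤ 1)
    (hr : EqOn r.integrand (fun v => Polynomial.aeval (v 0) N /
      Polynomial.aeval (v 0) ((Polynomial.C (s * k₁) + Polynomial.C (s * k₂) * Polynomial.X) *
        (Polynomial.C k₁ + Polynomial.C k₂ * Polynomial.X) ^ 2 *
        (Polynomial.C κ₀ + Polynomial.C κ₁ * Polynomial.X ^ 2)) * √(qD 0 0 m (v 0))) r.domain) :
    InBaker (KZ.of r) := by
  have hs' : (s : ℝ) ≠ 0 := by exact_mod_cast hs
  have hκ₀' : (0 : ℝ) < κ₀ := by exact_mod_cast hκ.1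
  have hκ₁' : (0 : ℝ) ≤ κ₁ := by exact_mod_cast hκ.2
  have hWx : ∀ x : ℝ, Polynomial.aeval x (Polynomial.C κ₀ + Polynomial.C κ₁ * Polynomial.X ^ 2) =
      κ₀ + κ₁ * x ^ 2 := fun x => by
    simp only [map_add, map_mul, map_pow, Polynomial.aeval_C, Polynomial.aeval_X, eq_ratCast]
  have hWpos : ∀ x : ℝ, (0 : ℝ) < κ₀ + κ₁ * x ^ 2 := fun x => by positivity
  rcases r.domain.eq_empty_or_nonempty with h0 | ⟨v₀, hv₀⟩
  · exact InBaker.of_domain_eq_empty r h0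
  by_cases hk₂ : k₂ = 0
  · have hk₁ : (k₁ : ℝ) ≠ 0 := by
      have h := hL (v₀ 0) (hdom v₀ hv₀).1 (hdom v₀ hv₀).2
      rwa [hk₂, Rat.cast_zero, zero_mul, add_zero] at h
    refine InBaker.sqrt_const_div_W m hm κ₀ κ₁ hκ.1 hκ.2 (Polynomial.C (s * k₁ ^ 3)⁻¹ * N) r hI
      fun v hv => ?_
    rw [hr hv, hk₂]
    beta_reduce
    simp only [hWx, map_add, map_mul, map_pow, Polynomial.aeval_C, Polynomial.aeval_X, eq_ratCast]
    have hW0 := (hWpos (v 0)).ne'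
    push_cast
    simp only [mul_zero, zero_mul, add_zero]
    field_simp
  -- `k₂ ≠ 0`: the pole `a = −k₁/k₂`
  have hk₂' : (k₂ : ℝ) ≠ 0 := by exact_mod_cast hk₂
  obtain ⟨a, ha⟩ : ∃ a : ℚ, a = -k₁ / k₂ := ⟨_, rfl⟩
  have hLa : ∀ x : ℝ, (k₁ : ℝ) + k₂ * x = k₂ * (x - a) := fun x => by
    rw [ha]; push_cast; field_simp; ring
  have hL' : ∀ x : ℝ, (lo : ℝ) ≤ x → x ≤ hi → x - a ≠ 0 := fun x h1 h2 hxa => by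
    have h := hL x h1 h2
    rw [hLa, hxa, mul_zero] at h
    exact h rfl
  refine InBaker.sqrt_const_div_LcubeW m hm κ₀ κ₁ hκ.1 hκ.2 a (s * k₂ ^ 3)
    (mul_ne_zero hs (pow_ne_zero 3 hk₂)) N lo hi hL' r hdom hI fun v hv => ?_
  rw [hr hv]
  beta_reduce
  congr 2
  simp only [map_add, map_sub, map_mul, map_pow, Polynomial.aeval_C, Polynomial.aeval_X, eq_ratCast]
  rw [ha]
  push_cast
  field_simp
  ring

end Summit.KontsevichZagierPeriods.RootDecompWalshStrata.ConicDescent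

end
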